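import Literature.NumberTheory.EllipticCurves.FormalGroupInvXVietaProofs
import Mathlib.RingTheory.PowerSeries.Derivative
import HarnessLib

/-!
# Formal logarithms along the formal group: `log(𝔖₁²D²)(1/x) = ℒ(z) + ℒ(i(z))` and its
# coefficients as power sums (proofs only)

Topic `Literature/NumberTheory/EllipticCurves` (trunk T-NT-EC); PROOFS file (theorems only: no
definition, no named fact, no instance). Sequel of `FormalGroupInvXVietaProofs.lean` (Vieta for
`z, i(z)` over `R⟦1/x⟧`; `𝔖₁(1/x)²·D(1/x)² = S·S(i(z))` for an even `Σ = z²S` with `x⁻¹`-expansion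
`𝔖 = w𝔖₁`) and `PadicLogOfEvalProofs.lean` (formal logarithms `dL·F = dF`). Width seat
`bsd-line-cf2-p1-w8` (g26), BSD cell `bsd-print-cf2`; the formal half of «the cyclotomic `p`-adic
height of a point with rational `x` over a number field equals the minus-twist receptacle»
(`CanonicalPAdicHeightCyc.lean`: `sigmaSqNormLog = 2 log_p N(z) + Σ ℒ_n Tr(zⁿ)`, `ℒ = log(Σ/z²)`).

## Results (commutative ring `R`; `IsAddTorsionFree R` where a primitive is recovered from its derivative)

FORMAL LOGARITHMS (`L` is a formal logarithm of `F` when `L(0) = 0`, `F(0) = 1`, `dL·F = dF`):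
* `derivative_add_mul_mul_eq` — `L + L′` is one of `F·F′`; `derivative_subst_mul_subst_eq` — `L∘g`
  is one of `F∘g` (`g(0) = 0`); `eq_of_derivative_mul_eq` — uniqueness.
POWER SUMS: for series `S_w, E_w ∈ R⟦w⟧` with `S_w(1/x) = z + i(z)`, `E_w(1/x) = z·i(z)` (the tree's
`sumSeries_subst_formalInvX`, `prodSeries_subst_formalInvX`) and the Newton sequence
`Π₀ = 2, Π₁ = S_w, Π_{n+2} = S_wΠ_{n+1} − E_wΠ_n` (`Pw` below):
* `powerSum_subst_formalInvX` — **`Π_n(1/x(z)) = zⁿ + i(z)ⁿ`**; `X_pow_dvd_powerSum`,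
  `coeff_powerSum_eq_zero` — `Π_n = O(w^{⌈n/2⌉})`.
THE LOG IDENTITY: for an even `Σ = z² + ⋯` with `x⁻¹`-expansion `𝔖`, `S = Σ/z²`, `𝔖₁ = 𝔖/w`,
`D = 1 + a₂w + a₄w² + a₆w³`, and formal logarithms `ℒ` of `S`, `L₁` of `𝔖₁`, `L_D` of `D`:
* `two_mul_add_subst_formalInvX_eq` — **`(2L₁ + 2L_D)(1/x(z)) = ℒ(z) + ℒ(i(z))`** (both are formal
  logarithms of `𝔖₁(1/x)²D(1/x)² = S·S(i(z))`);
* `coeff_eq_sum_coeff_mul_coeff_powerSum` — **`[w^k]M = Σ_{n ≤ 2k} [zⁿ]ℒ · [w^k]Π_n`** for every `M`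
  with `M(1/x) = ℒ + ℒ∘i` (injectivity of `S ↦ S(1/x)`, `IsInvXExpansion.unique`): the coefficients
  of `2 log(𝔖(w)/w) + 2 log D(w)` are the `ℒ`-weighted power sums — the formal shadow of
  `Σ_{τ : H → ℚ̄_p} ℒ(τ z) = Σ_n ℒ_n Tr_{H/ℚ}(zⁿ)`.

Nothing about heights or BSD is proved here; no analysis (that is `PadicLogOfEvalProofs.lean`).

## References

* J. H. Silverman, *The Arithmetic of Elliptic Curves*, 2nd ed. (2009), IV.1 (formal group, `i(z)`),
  IV.4–IV.5 (formal logarithm). [SilvermanAEC2009]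
* B. Mazur, W. Stein, J. Tate, Doc. Math. Extra Vol. Coates (2006), §2.7–2.8 (`h_p` via `σ_v`,
  `ρ^K_cycl = ρ^ℚ_cycl ∘ N_{K/ℚ}`). [MazurSteinTate2006]
* N. Bourbaki, *Algebra II*, IV.§4 (substitution, derivations of formal power series), IV.§6 no. 1
  (Newton's relations for power sums). [BourbakiAlgebraII2003]
-/

noncomputable section

open scoped Classical
open PowerSeries Literature.NumberTheory.EllipticCurves

/-! ### §1 Formal logarithms: products, substitution, uniqueness -/

namespace Literature.NumberTheory.EllipticCurves

section FormalLog

variable {R : Type*} [CommRing R]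

/-- **The formal logarithm of a product is the sum**: if `dL·F = dF` and `dL′·F′ = dF′` then
`d(L + L′)·(FF′) = d(FF′)` (Leibniz). [cite: BourbakiAlgebraII2003, IV.§4 no. 3] -/
theorem derivative_add_mul_mul_eq {L L' F F' : R⟦X⟧} (hL : d⁄dX R L * F = d⁄dX R F)
    (hL' : d⁄dX R L' * F' = d⁄dX R F') :
    d⁄dX R (L + L') * (F * F') = d⁄dX R (F * F') := by
  rw [map_add, Derivation.leibniz, smul_eq_mul, smul_eq_mul]
  linear_combination F' * hL + F * hL'

/-- **The formal logarithm of a composite**: if `dL·F = dF` and `g(0) = 0` then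
`d(L∘g)·(F∘g) = d(F∘g)` (chain rule, `PowerSeries.derivative_subst`).
[cite: BourbakiAlgebraII2003, IV.§4 no. 3] -/
theorem derivative_subst_mul_subst_eq {L F g : R⟦X⟧} (hL : d⁄dX R L * F = d⁄dX R F)
    (hg : constantCoeff g = 0) :
    d⁄dX R (L.subst g) * F.subst g = d⁄dX R (F.subst g) := by
  have hs : HasSubst g := HasSubst.of_constantCoeff_zero' hg
  have h := congrArg (PowerSeries.subst g) hL
  rw [subst_mul hs] at h
  rw [derivative_subst R hs, derivative_subst R hs]
  linear_combination (d⁄dX R g) * h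

/-- **Uniqueness of the formal logarithm**: two series with the same constant term whose derivatives
times `F` (`F(0) = 1`) both equal `dF` coincide (`R` additively torsion-free).
[cite: BourbakiAlgebraII2003, IV.§4 no. 3] -/
theorem eq_of_derivative_mul_eq [IsAddTorsionFree R] {L L' F : R⟦X⟧} (hF0 : constantCoeff F = 1)
    (hL : d⁄dX R L * F = d⁄dX R F) (hL' : d⁄dX R L' * F = d⁄dX R F)
    (h0 : constantCoeff L = constantCoeff L') : L = L' := by
  refine derivative.ext ?_ h0
  have hu : IsUnit F := isUnit_iff_constantCoeff.mpr (by rw [hF0]; exact isUnit_one)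
  exact hu.mul_left_inj.mp (hL.trans hL'.symm)

end FormalLog

end Literature.NumberTheory.EllipticCurves

namespace WeierstrassCurve

variable {R : Type*} [CommRing R] (W : WeierstrassCurve R)

/-! ### §2 Newton power sums of `z` and `i(z)` as series in `1/x` -/

section PowerSums

variable {W}
variable {Sw Ew : R⟦X⟧} (hSw : Sw.subst W.formalInvX = X + W.formalNeg)
  (hEw : Ew.subst W.formalInvX = X * W.formalNeg) (Pw : ℕ → R⟦X⟧) (hPw0 : Pw 0 = 2)
  (hPw1 : Pw 1 = Sw) (hPw : ∀ n, Pw (n + 2) = Sw * Pw (n + 1) - Ew * Pw n)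

include hSw hEw hPw0 hPw1 hPw in
/-- **`Π_n(1/x(z)) = zⁿ + i(z)ⁿ`** for the Newton sequence `Π₀ = 2`, `Π₁ = S_w`,
`Π_{n+2} = S_wΠ_{n+1} − E_wΠ_n` (`Pw n` in the statement) built from series with `S_w(1/x) = z + i(z)`, `E_w(1/x) = z·i(z)`
(Newton's identity `p_{n+2} = e₁p_{n+1} − e₂p_n` for two roots).
[cite: BourbakiAlgebraII2003, IV.§6 no. 1] [cite: SilvermanAEC2009, IV.1.1] -/
theorem powerSum_subst_formalInvX (n : ℕ) :
    (Pw n).subst W.formalInvX = X ^ n + W.formalNeg ^ n := by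
  have hs := W.hasSubst_formalInvX
  suffices h : ∀ m, (Pw m).subst W.formalInvX = X ^ m + W.formalNeg ^ m ∧
      (Pw (m + 1)).subst W.formalInvX = X ^ (m + 1) + W.formalNeg ^ (m + 1) from (h n).1
  intro m
  induction m with
  | zero =>
    refine ⟨?_, ?_⟩
    · rw [hPw0, show (2 : R⟦X⟧) = C (2 : R) from (map_ofNat C 2).symm, subst_C, pow_zero, pow_zero,
        map_ofNat]
      norm_num
    · rw [zero_add, hPw1, hSw, pow_one, pow_one]
  | succ m ih =>
    refine ⟨ih.2, ?_⟩
    rw [show m + 1 + 1 = m + 2 from rfl, hPw m, subst_sub hs, subst_mul hs, subst_mul hs, hSw, hEw,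
      ih.1, ih.2]
    ring

variable (hSw0 : constantCoeff Sw = 0) (hEw0 : constantCoeff Ew = 0)

include hPw1 hPw hSw0 hEw0 in
/-- **`w^{⌈n/2⌉} ∣ Π_n`** (`S_w, E_w ∈ wR⟦w⟧`; `⌈n/2⌉ = (n+1)/2` in `ℕ`): the power sums of `z, i(z)`,
of order `n` in `z`, have order `≥ n/2` in `w = 1/x = z² + ⋯`. [cite: BourbakiAlgebraII2003, IV.§6 no. 1] -/
theorem X_pow_dvd_powerSum (n : ℕ) : X ^ ((n + 1) / 2) ∣ Pw n := by
  have hS : (X : R⟦X⟧) ∣ Sw := X_dvd_iff.mpr hSw0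
  have hE : (X : R⟦X⟧) ∣ Ew := X_dvd_iff.mpr hEw0
  suffices h : ∀ m, X ^ ((m + 1) / 2) ∣ Pw m ∧ X ^ ((m + 2) / 2) ∣ Pw (m + 1) from (h n).1
  intro m
  induction m with
  | zero =>
    refine ⟨by simp, ?_⟩
    rw [zero_add, hPw1, show (0 + 2) / 2 = 1 from rfl, pow_one]
    exact hS
  | succ m ih =>
    refine ⟨ih.2, ?_⟩
    rw [show m + 1 + 1 = m + 2 from rfl, hPw m, show (m + 1 + 2) / 2 = (m + 1) / 2 + 1 by omega]
    refine dvd_sub ?_ ?_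
    · have h1 : X ^ ((m + 1) / 2 + 1) ∣ X * Pw (m + 1) := by
        rw [pow_succ, mul_comm]
        exact mul_dvd_mul_left X ((pow_dvd_pow X (by omega)).trans ih.2)
      exact h1.trans (mul_dvd_mul_right hS _)
    · rw [pow_succ, mul_comm]
      exact mul_dvd_mul hE ih.1

include hPw1 hPw hSw0 hEw0 in
/-- `[w^k]Π_n = 0` for `2k < n`. [cite: BourbakiAlgebraII2003, IV.§6 no. 1] -/
theorem coeff_powerSum_eq_zero {n k : ℕ} (h : 2 * k < n) : coeff k (Pw n) = 0 := by
  obtain ⟨q, hq⟩ := X_pow_dvd_powerSum Pw hPw1 hPw hSw0 hEw0 n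
  rw [hq, coeff_X_pow_mul', if_neg (by omega)]

end PowerSums

/-! ### §3 The log identity `(2L₁ + 2L_D)(1/x) = ℒ(z) + ℒ(i(z))` -/

section LogIdentity

variable {W}
variable [IsAddTorsionFree R] {Sq Sx : R⟦X⟧} (hinv : W.IsInvXExpansion Sq Sx)
  (h0 : constantCoeff Sq = 0) (h1 : coeff 1 Sq = 0) (h2 : coeff 2 Sq = 1)
  (heven : W.IsFormallyEven Sq)
  {ℒ L₁ L_D : R⟦X⟧} (hℒ0 : constantCoeff ℒ = 0)
  (hℒ : d⁄dX R ℒ * sigmaShift (sigmaShift Sq) = d⁄dX R (sigmaShift (sigmaShift Sq)))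
  (hL₁0 : constantCoeff L₁ = 0) (hL₁ : d⁄dX R L₁ * sigmaShift Sx = d⁄dX R (sigmaShift Sx))
  (hLD0 : constantCoeff L_D = 0)
  (hLD : d⁄dX R L_D * (1 + C W.a₂ * X + C W.a₄ * X ^ 2 + C W.a₆ * X ^ 3) =
    d⁄dX R (1 + C W.a₂ * X + C W.a₄ * X ^ 2 + C W.a₆ * X ^ 3 : R⟦X⟧))

include hinv h0 h1 h2 heven hℒ0 hℒ hL₁0 hL₁ hLD0 hLD in
/-- **`(2L₁ + 2L_D)(1/x(z)) = ℒ(z) + ℒ(i(z))`** for the formal logarithms `ℒ = log(Σ/z²)`,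
`L₁ = log(𝔖/w)`, `L_D = log D` of an even `Σ` with `x⁻¹`-expansion `𝔖`: both sides have zero constant
term and are formal logarithms of the same series `𝔖₁(1/x)²D(1/x)² = S·S(i(z))`
(`sq_sigmaShift_invX_subst_mul`). This is `log Σ(z) + log Σ(z̄) = 2 log(z z̄) + 2 log(𝔖(w)/w) + 2 log D(w)`
at `w = 1/x`, `z̄ = i(z)`, with the `log(z z̄) = log(−w/D)` bookkeeping removed.
[cite: MazurSteinTate2006, §2.8] [cite: Silverman2005DivPoly, §5 Rem. 2] -/
theorem two_mul_add_subst_formalInvX_eq :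
    (2 * L₁ + 2 * L_D).subst W.formalInvX = ℒ + ℒ.subst W.formalNeg := by
  have hsι := W.hasSubst_formalInvX
  set S := sigmaShift (sigmaShift Sq) with hSdef
  set S₁ := sigmaShift Sx with hS₁def
  set Dw : R⟦X⟧ := 1 + C W.a₂ * X + C W.a₄ * X ^ 2 + C W.a₆ * X ^ 3 with hDw
  set Dι := 1 + C W.a₂ * W.formalInvX + C W.a₄ * W.formalInvX ^ 2 + C W.a₆ * W.formalInvX ^ 3
    with hDι
  have hS0 : constantCoeff S = 1 := constantCoeff_sigmaShift_sigmaShift h2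
  -- the common series `G = S · S(i)` and its two formal logarithms
  set G := S * S.subst W.formalNeg with hG
  have hG0 : constantCoeff G = 1 := by
    rw [hG, map_mul, constantCoeff_subst_of_constantCoeff S W.constantCoeff_formalNeg, hS0, mul_one]
  -- right-hand side
  have hR : d⁄dX R (ℒ + ℒ.subst W.formalNeg) * G = d⁄dX R G :=
    derivative_add_mul_mul_eq hℒ (derivative_subst_mul_subst_eq hℒ W.constantCoeff_formalNeg)
  -- left-hand side: `2L₁ + 2L_D` is a formal logarithm of `S₁² Dw²`
  have hM : d⁄dX R (2 * L₁ + 2 * L_D) * (S₁ * S₁ * (Dw * Dw)) = d⁄dX R (S₁ * S₁ * (Dw * Dw)) := by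
    rw [two_mul, two_mul]
    exact derivative_add_mul_mul_eq (derivative_add_mul_mul_eq hL₁ hL₁) (derivative_add_mul_mul_eq hLD hLD)
  have hL : d⁄dX R ((2 * L₁ + 2 * L_D).subst W.formalInvX) * G = d⁄dX R G := by
    have h := derivative_subst_mul_subst_eq hM W.constantCoeff_formalInvX
    have hF : (S₁ * S₁ * (Dw * Dw)).subst W.formalInvX = G := by
      rw [subst_mul hsι, subst_mul hsι, subst_mul hsι, W.cubicD_subst_formalInvX, ← hDι, hG,
        ← sq_sigmaShift_invX_subst_mul hinv h0 h1 heven]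
      ring
    rwa [hF] at h
  refine eq_of_derivative_mul_eq hG0 hL hR ?_
  rw [constantCoeff_subst_of_constantCoeff _ W.constantCoeff_formalInvX, map_add, map_add, map_mul,
    map_mul, hL₁0, hLD0, mul_zero, add_zero, hℒ0, zero_add,
    constantCoeff_subst_of_constantCoeff _ W.constantCoeff_formalNeg, hℒ0]

end LogIdentity

/-! ### §4 Coefficients of `M` with `M(1/x) = ℒ + ℒ∘i` are `ℒ`-weighted power sums -/

section Coefficients

variable {W}
variable {Sw Ew : R⟦X⟧} (hSw : Sw.subst W.formalInvX = X + W.formalNeg)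
  (hEw : Ew.subst W.formalInvX = X * W.formalNeg) (hSw0 : constantCoeff Sw = 0)
  (hEw0 : constantCoeff Ew = 0) (Pw : ℕ → R⟦X⟧) (hPw0 : Pw 0 = 2) (hPw1 : Pw 1 = Sw)
  (hPw : ∀ n, Pw (n + 2) = Sw * Pw (n + 1) - Ew * Pw n)
  {M ℒ : R⟦X⟧} (hM : M.subst W.formalInvX = ℒ + ℒ.subst W.formalNeg)

include hSw hEw hSw0 hEw0 hPw0 hPw1 hPw hM in
/-- **`[w^k]M = Σ_{n ≤ 2k} [zⁿ]ℒ · [w^k]Π_n`** whenever `M(1/x(z)) = ℒ(z) + ℒ(i(z))`: the series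
`M̃ = Σ_n ℒ_n Pw_n` (a `w`-adically convergent sum, `Pw_n = O(w^{⌈n/2⌉})`, written coefficientwise) has
`M̃(1/x) = Σ_n ℒ_n (zⁿ + i(z)ⁿ) = ℒ + ℒ∘i = M(1/x)`, and `S ↦ S(1/x)` is injective
(`IsInvXExpansion.unique`). [cite: MazurSteinTate2006, §2.8] [cite: BourbakiAlgebraII2003, IV.§6 no. 1] -/
theorem coeff_eq_sum_coeff_mul_coeff_powerSum (k : ℕ) :
    coeff k M = ∑ n ∈ Finset.range (2 * k + 1), coeff n ℒ * coeff k (Pw n) := by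
  -- the candidate series
  set Mt : R⟦X⟧ := PowerSeries.mk fun k => ∑ n ∈ Finset.range (2 * k + 1), coeff n ℒ * coeff k (Pw n)
    with hMt
  have hπ0 : ∀ {n k : ℕ}, 2 * k < n → coeff k (Pw n) = 0 := fun h =>
    coeff_powerSum_eq_zero Pw hPw1 hPw hSw0 hEw0 h
  have hPι : ∀ n, (Pw n).subst W.formalInvX = X ^ n + W.formalNeg ^ n :=
    powerSum_subst_formalInvX hSw hEw Pw hPw0 hPw1 hPw
  -- `Mt(1/x) = ℒ + ℒ(i)` coefficientwise
  have key : Mt.subst W.formalInvX = ℒ + ℒ.subst W.formalNeg := by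
    ext m
    rw [coeff_subst_eq_sum_range_of_constantCoeff Mt W.constantCoeff_formalInvX, map_add,
      coeff_subst_eq_sum_range_of_constantCoeff ℒ W.constantCoeff_formalNeg]
    -- rewrite `ℒ_m` as `Σ_n ℒ_n [z^m] z^n` and combine with the `i`-part through `Pw_n(1/x)`
    have hXpart : coeff m ℒ = ∑ n ∈ Finset.range (m + 1), coeff n ℒ * coeff m ((X : R⟦X⟧) ^ n) := by
      rw [Finset.sum_eq_single m]
      · rw [coeff_X_pow_self, mul_one]
      · intro n _ hn
        rw [coeff_X_pow, if_neg (Ne.symm hn), mul_zero]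
      · intro h
        exact absurd (Finset.self_mem_range_succ m) h
    have hRHS : coeff m ℒ + ∑ n ∈ Finset.range (m + 1), coeff n ℒ * coeff m (W.formalNeg ^ n) =
        ∑ n ∈ Finset.range (m + 1), coeff n ℒ *
          ∑ k ∈ Finset.range (m + 1), coeff k (Pw n) * coeff m (W.formalInvX ^ k) := by
      rw [hXpart, ← Finset.sum_add_distrib]
      refine Finset.sum_congr rfl fun n _ => ?_
      rw [← mul_add, ← map_add, ← hPι n,
        coeff_subst_eq_sum_range_of_constantCoeff (Pw n) W.constantCoeff_formalInvX]
    rw [hRHS]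
    simp only [hMt, coeff_mk, Finset.sum_mul, Finset.mul_sum]
    -- both sides equal the sum over the rectangle `k ≤ m`, `n ≤ 2m`
    have hL : ∑ k ∈ Finset.range (m + 1), ∑ n ∈ Finset.range (2 * k + 1),
        coeff n ℒ * coeff k (Pw n) * coeff m (W.formalInvX ^ k) =
        ∑ k ∈ Finset.range (m + 1), ∑ n ∈ Finset.range (2 * m + 1),
          coeff n ℒ * coeff k (Pw n) * coeff m (W.formalInvX ^ k) := by
      refine Finset.sum_congr rfl fun k hk => ?_
      have hk' := Finset.mem_range.mp hk
      refine Finset.sum_subset (Finset.range_subset_range.mpr (by omega)) fun n hn hn' => ?_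
      have hn1 := Finset.mem_range.mp hn
      rw [Finset.mem_range, not_lt] at hn'
      rw [hπ0 (by omega), mul_zero, zero_mul]
    have hR : ∑ n ∈ Finset.range (m + 1), ∑ k ∈ Finset.range (m + 1),
        coeff n ℒ * (coeff k (Pw n) * coeff m (W.formalInvX ^ k)) =
        ∑ k ∈ Finset.range (m + 1), ∑ n ∈ Finset.range (2 * m + 1),
          coeff n ℒ * coeff k (Pw n) * coeff m (W.formalInvX ^ k) := by
      rw [Finset.sum_comm]
      refine Finset.sum_congr rfl fun k hk => ?_
      have hk' := Finset.mem_range.mp hk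
      calc ∑ n ∈ Finset.range (m + 1), coeff n ℒ * (coeff k (Pw n) * coeff m (W.formalInvX ^ k))
          = ∑ n ∈ Finset.range (m + 1), coeff n ℒ * coeff k (Pw n) * coeff m (W.formalInvX ^ k) :=
            Finset.sum_congr rfl fun n _ => by ring
        _ = ∑ n ∈ Finset.range (2 * m + 1), coeff n ℒ * coeff k (Pw n) * coeff m (W.formalInvX ^ k) :=
            Finset.sum_subset (Finset.range_subset_range.mpr (by omega)) fun n hn hn' => by
              rw [Finset.mem_range, not_lt] at hn'
              by_cases hnk : 2 * k < n
              · rw [hπ0 hnk, mul_zero, zero_mul]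
              · rw [W.coeff_formalInvX_pow_eq_zero_of_lt (show m < 2 * k by omega), mul_zero]
    rw [hL, hR]
  -- injectivity of `S ↦ S(1/x)`
  have hEq : Mt = M :=
    IsInvXExpansion.unique (W := W) (Sq := M.subst W.formalInvX) (key.trans hM.symm) rfl
  rw [← hEq, hMt, coeff_mk]

end Coefficients

end WeierstrassCurve

end
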